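import Summits.BirchSwinnertonDyer.BirchSwinnertonDyer.Theses.CongruentShaFreeCut
import Summits.BirchSwinnertonDyer.BirchSwinnertonDyer.Theorems.CongruentShaFreeCutHeegnerFieldData
import Literature.NumberTheory.EllipticCurves.BSDSelmerCMPConverse
import Literature.NumberTheory.EllipticCurves.Kriz2020.GoldfeldJ1728Proofs
import Literature.NumberTheory.EllipticCurves.LiLiuTian2024.CongruentNumberFullBSD

/-! # Route `CongruentShaFreeCut` (rung S2) — crux `AnalyticRankOneOfRankOneFiniteShaTwo`
(stmt-BirchSwinnertonDyer-19080) modulo ONE named `K`-level statement, and back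

The registered BC3 skeleton of crux B (line `heegner-field-gz`, plan g8, sha16 d981ef2b) composes
`stub_heegnerFieldData → stub_twoConverseOverK → AnalyticRankOneOfRankOneFiniteShaTwo`. Stub 1 is a
tree theorem modulo four REFEREED named facts
(`CongruentShaFreeCutHeegnerFieldData.heegnerFieldData_of_parity_of_hoffsteinLuo_of_kato`, p412976:
`2`-parity `p_parity`, Modularity `ModularForms.exists_isNewformOf`, Hoffstein–Luo 1997
`HoffsteinLuo1997_exists_twist_L_one_ne_zero`, Kato 2004 Cor. 14.3 `kato_finite_of_L_one_ne_zero`).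
Stub 2 — the `K`-level Ш-finite `2`-converse for `E_n : y² = x³ − n²x` over an auxiliary imaginary
quadratic `K` with the full-conductor Heegner hypothesis and `2` split — is the research-grade load
(a Rubin/BDP-type formula + explicit reciprocity law at the ADDITIVE prime `2`; Fan–Wan
arXiv:2304.09806v2 Thm. 4.2/4.4 + 6.9, unrefereed; refereed models stop at good reduction:
BKO 2024 Thm. 1.5 inert `p ≥ 5`, Burungale–Tian 2020 ordinary `p > 3`, BCST 2022). This file

* NAMES stub 2 as the proposition `TwoConverseOverK` (token-identical to the registered
  `stub_twoConverseOverK`; nothing asserted);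
* proves **crux B modulo `TwoConverseOverK` and the four refereed facts**
  (`analyticRankOne_of_facts_of_twoConverseOverK` — the skeleton's composition with the landed
  helper in place of stub 1), so that crux B is a tree theorem modulo exactly ONE named research
  statement;
* proves the converse bookkeeping **`TwoConverseOverK` from crux B** modulo Modularity and the
  REFEREED rank-zero `2`-converse of Burungale–Tian, Ann. of Math. 203 (2026) Thm. 1.1
  (`burungaleTian_analyticRank_eq_zero_of_selmerCorank_eq_zero_of_hasCM`, any prime, any CM curve
  over `ℚ`) (`twoConverseOverK_of_cruxB_of_burungaleTian`): by `L(E_n/K, s) = L(E_n, s) ·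
  L(E_n^{(d_K)}, s)` with `E_n^{(d_K)} = E_{n|d_K|}` (`quadraticTwist_congruentNumberCurve`)
  and corank / rank additivity over `K/ℚ`, the `K`-level statement is crux B for one member of the
  pair `{E_n, E_{n|d_K|}}` plus the rank-ZERO converse for the other. Hence stub 2 carries no open
  content beyond crux B itself: **`TwoConverseOverK ↔ crux B` modulo refereed facts** — the cut of
  record is faithful, and (numbers, not adjectives) the research debt of the line is crux B, not less.
Supports, does not close, stmt-BirchSwinnertonDyer-19080. -/

namespace Summit.BirchSwinnertonDyer.BirchSwinnertonDyer.Theorems.CongruentShaFreeCutOfTwoConverseOverK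

open Literature.NumberTheory.EllipticCurves WeierstrassCurve
open Summit.BirchSwinnertonDyer.BirchSwinnertonDyer.Theses.CongruentShaFreeCut

/-- **`TwoConverseOverK` — the `K`-level Ш-finite `2`-converse for the congruent number family**
(= the registered stub `stub_twoConverseOverK` of the BC3 skeleton of crux
`AnalyticRankOneOfRankOneFiniteShaTwo`, line `heegner-field-gz`, token for token; OPEN,
research-grade; nothing asserted). For every `n ≠ 0` and every imaginary quadratic field `K`
satisfying the Heegner hypothesis for the conductor `N(E_n)` and for `2` (so `2` splits in `K`):
`corank_{ℤ₂} Sel_{2^∞}(E_n/K) = 1 ∧ rank E_n(K) = 1 ⟹ ord_{s=1} L(E_n/K, s) = 1`. Intended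
mechanism: a Rubin/BDP-type formula for the `2`-adic anticyclotomic `L`-value at the trivial
character as `(log_ω P)²`, `P ∈ E_n(K)` of infinite order, an explicit reciprocity law, and
Gross–Zagier–Kolyvagin over `K` — in refereed print only at primes of GOOD reduction (BKO, JIMJ 23
(2024) Thm. 1.5: inert `p ≥ 5`; Burungale–Tian, Invent. Math. 220 (2020) Thm. 1.2: ordinary
`p > 3`); `2` is ADDITIVE for `E_n`. Claimed at `p = 2` by Fan–Wan, arXiv:2304.09806v2, Thm. 1.1
(unrefereed; cell verdict HOME/VERDICT.md). Equivalent to crux B modulo refereed facts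
(`analyticRankOne_of_facts_of_twoConverseOverK`, `twoConverseOverK_of_cruxB_of_burungaleTian`). -/
@[conjecture] def TwoConverseOverK : Prop :=
  ∀ ⦃n : ℕ⦄, n ≠ 0 → ∀ (K : Type) [Field K] [NumberField K],
    IsImaginaryQuadratic K →
      SatisfiesHeegnerHypothesis ((congruentNumberCurve n).conductorNorm ℤ) K →
        SatisfiesHeegnerHypothesis 2 K →
          ((congruentNumberCurve n).baseChange K).selmerCorank 2 = 1 →
            ((congruentNumberCurve n).baseChange K).mordellWeilRank = 1 →
              analyticRankEK (congruentNumberCurve n) K = 1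

/-- **Crux B modulo ONE named `K`-level statement and four refereed facts.** Granted `2`-parity
(`hpar`), Modularity (`hmod`), Hoffstein–Luo (`hHL`), Kato (`hKato`) and `TwoConverseOverK` (`hK2`),
for every `n ≠ 0`: `rank E_n(ℚ) = 1 ∧ #Ш(E_n/ℚ)[2^∞] < ∞ ⟹ ord_{s=1} L(E_n, s) = 1`. Proof = the
registered skeleton's composition: the landed helper
`heegnerFieldData_of_parity_of_hoffsteinLuo_of_kato` supplies an imaginary quadratic `K` (Heegner
hypothesis for `N(E_n)` and `2`, corank and rank one over `K`, `ord L(E_n/K) = ord L(E_n)`), and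
`hK2` gives `ord_{s=1} L(E_n/K, s) = 1`.
[cite: BurungaleKobayashiOta2023, Thm. 1.5 (JIMJ 23 (2024), p. 1422) — the model at inert p ≥ 5] -/
theorem analyticRankOne_of_facts_of_twoConverseOverK
    (hpar : ∀ (W : WeierstrassCurve ℚ) [W.IsElliptic] (p : ℕ) [Fact p.Prime], p_parity W p)
    (hmod : ModularForms.exists_isNewformOf) (hHL : HoffsteinLuo1997_exists_twist_L_one_ne_zero)
    (hKato : ∀ (W : WeierstrassCurve ℚ) [W.IsElliptic] (p : ℕ) [Fact p.Prime],
      kato_finite_of_L_one_ne_zero W p)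
    (hK2 : TwoConverseOverK) :
    AnalyticRankOneOfRankOneFiniteShaTwo := by
  intro n hn hr hfin
  obtain ⟨K, _, _, hK, hHN, hH2, hcK, hrK, hfac⟩ :=
    CongruentShaFreeCutHeegnerFieldData.heegnerFieldData_of_parity_of_hoffsteinLuo_of_kato hpar hmod
      hHL hKato hn hr hfin
  have h := hK2 hn K hK hHN hH2 hcK hrK
  rwa [hfac] at h

/-- **`TwoConverseOverK` from crux B, modulo Modularity and Burungale–Tian's rank-zero
`2`-converse** (the cut is faithful: stub 2 ≡ crux B modulo refereed facts). Given
`corank_{ℤ₂} Sel_{2^∞}(E_n/K) = 1` and `rank E_n(K) = 1`, additivity over the quadratic `K/ℚ`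
(tree theorems `selmerCorank_baseChange_quadratic_holds`, `mordellWeilRank_baseChange_quadratic_holds`)
and `rank ≤ corank` (Greenberg's identity `selmerCorank_eq_mordellWeilRank_add_holds`) leave two
cases: the member of `{E_n, E_n^{(d_K)} = E_{n|d_K|}}` (`quadraticTwist_congruentNumberCurve`) with
corank `1` has rank `1` and `Ш[2^∞]` finite (`finite_primaryComponent_sha_iff_shaCorank_eq_zero`),
so analytic rank `1` by crux B (`hB`); the other has corank `0`, so analytic rank `0` by
Burungale–Tian 2026 Thm. 1.1 (`hBT`; `E_n` and its twists have CM by `ℤ[i]`). Artin formalism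
`ord L(E_n/K) = ord L(E_n) + ord L(E_n^{(d_K)})` (`analyticRankEK_eq_add_of`, from Modularity
`hmod`) concludes. The Heegner hypotheses of `TwoConverseOverK` are not used.
[cite: BurungaleTian2026, Thm. 1.1] [cite: GrossZagier1986, I.§7] -/
theorem twoConverseOverK_of_cruxB_of_burungaleTian (hmod : ModularForms.exists_isNewformOf)
    (hBT : burungaleTian_analyticRank_eq_zero_of_selmerCorank_eq_zero_of_hasCM)
    (hB : AnalyticRankOneOfRankOneFiniteShaTwo) : TwoConverseOverK := by
  intro n hn K _ _ hK _ _ hcK hrK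
  haveI := isElliptic_congruentNumberCurve hn
  haveI : Fact (Nat.Prime 2) := ⟨Nat.prime_two⟩
  have hd0 : NumberField.discr K ≠ 0 := NumberField.discr_ne_zero K
  have hm : n * (NumberField.discr K).natAbs ≠ 0 :=
    Nat.mul_ne_zero hn (Int.natAbs_ne_zero.mpr hd0)
  haveI := isElliptic_congruentNumberCurve hm
  -- Artin formalism and additivity over `K/ℚ`, with `E_n^{(d_K)} = E_{n|d_K|}`
  rw [analyticRankEK_eq_add_of (hasEntireLFunction_rat_of_exists_isNewformOf hmod)
    (congruentNumberCurve n) K, quadraticTwist_congruentNumberCurve]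
  rw [selmerCorank_baseChange_quadratic_holds (congruentNumberCurve n) K hK.1 2,
    quadraticTwist_congruentNumberCurve] at hcK
  rw [mordellWeilRank_baseChange_quadratic_holds (congruentNumberCurve n) K hK.1,
    quadraticTwist_congruentNumberCurve] at hrK
  -- Greenberg's identity `corank = rank + corank Ш` for both members
  have hadd := (congruentNumberCurve n).selmerCorank_eq_mordellWeilRank_add_holds 2
  have hadd' :=
    (congruentNumberCurve (n * (NumberField.discr K).natAbs)).selmerCorank_eq_mordellWeilRank_add_holds 2
  rcases Nat.eq_zero_or_pos ((congruentNumberCurve n).selmerCorank 2) with h0 | hpos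
  · -- `E_n` has corank `0` (analytic rank `0` by Burungale–Tian), the twist carries crux B
    have han : (congruentNumberCurve n).analyticRank = 0 :=
      hBT _ (LiLiuTian2024.hasCM_congruentNumberCurve n) 2 h0
    have hr' : (congruentNumberCurve (n * (NumberField.discr K).natAbs)).mordellWeilRank = 1 := by
      omega
    have hs' : (congruentNumberCurve (n * (NumberField.discr K).natAbs)).shaCorank 2 = 0 := by
      omega
    have han' := hB hm hr' ((finite_primaryComponent_sha_iff_shaCorank_eq_zero _ 2).2 hs')
    omega
  · -- `E_n` has corank `1`: it carries crux B, the twist has corank `0`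
    have h0' : (congruentNumberCurve (n * (NumberField.discr K).natAbs)).selmerCorank 2 = 0 := by
      omega
    have han' : (congruentNumberCurve (n * (NumberField.discr K).natAbs)).analyticRank = 0 :=
      hBT _ (LiLiuTian2024.hasCM_congruentNumberCurve _) 2 h0'
    have hr : (congruentNumberCurve n).mordellWeilRank = 1 := by omega
    have hs : (congruentNumberCurve n).shaCorank 2 = 0 := by omega
    have han := hB hn hr ((finite_primaryComponent_sha_iff_shaCorank_eq_zero _ 2).2 hs)
    omega

end Summit.BirchSwinnertonDyer.BirchSwinnertonDyer.Theorems.CongruentShaFreeCutOfTwoConverseOverK
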